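import Summits.BirchSwinnertonDyer.BirchSwinnertonDyer.Theorems.PrintCf2RubinValueTwoAvatarOnRayDegreeOne
import HarnessLib

/-!
# The avatar on the ray subgroup is EXACTLY the one-variable monomial when the other places above `p`
# carry exponent zero — de Shalit II.4.14 (36)/(38) at `j = 0`: `ε̂ = (e_p ∘ κ_v)^{−m}` ON `Gal(K̄/K(𝔪))`

Cell `bsd-print-cf2`, width seat `bsd-line-cf2-p1-w5` g15; construction lane of the print leaf
`KatzDistributionsAtTwoPrint` (stmt-BirchSwinnertonDyer-24720), assembler piece **A2** of the LEAD's map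
(`Cruxes/KatzDistributionsAtTwoPrint/Lines/katz_measure_two.md` v2: "exact avatar identity on
`Gal(K̄/K(cond ε))` — `ê = (e₂κ_v)^{−m}`"). Theorems only; no `sorry`. BSD is not proved by any of this;
nothing is closed by this file.

`PrintCf2RubinValueTwoAvatarOnRaySubgroup.lean` / `…DegreeOne.lean` (-w5 g13) prove the CONGRUENCE
`‖ε̂(σ) − Λ(⟨κσ⟩_v)⁻¹‖ ≤ p^{−N}` on `Gal(K̄/K(𝔪))` for `𝔪` deep enough at the OTHER places `w ∣ p`, `w ≠ v`
(the error comes from the components `e_w`, `w ∣ p`, `w ≠ v`, of the ray idele `e` with `σ^{ab} = [e, K]`,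
which are principal units of depth `ord_w 𝔪` but otherwise unknown). When the infinity type `(pp, qq)`
gives EXPONENT ZERO to every local embedding above `p` away from `v` — the case `(−m, 0)` of the R3 endpoint
(`j = 0`) over an imaginary quadratic `K` with `p = v v̄` split, where the conjugate embedding lands at `v̄`
and carries `qq = 0` — those components do not enter `Λ` at all and the identity is EXACT, with no depth
hypothesis at `v̄`:

* §1 `coe_algPart_eq_one_of_exponent_eq_zero` — `Λ(y) = 1` for an idele `y` with `y_v = 1` when every local
  embedding `(w, ẽ)`, `w ≠ v`, has exponent `0`; ★ `avatarValueAt_eq_algPart_inv_localUnits` —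
  **`ε̂(σ) = Λ(⟨κσ⟩_v)⁻¹` EXACTLY** on `Gal(K̄/K(𝔪))` (`K` totally complex, module of definition `≤ 𝔪`,
  `v ∤ 𝔪`, `w_𝔪 = 1`, any avatar);
* §2 at a place `v` of DEGREE ONE which is THE place of `ι⁻¹ ∘ σ_{w₀}`:
  ★★ `avatarValueAt_eq_padicIntCast_zpow` — **`ε̂(σ) = padicIntCast ℂ_[p] (e_p (κσ)) ^ (pp w₀)`**;
* §3 the exponent hypothesis DISCHARGED for a `K` with a single infinite place (imaginary quadratic) and
  `qq w₀ = 0`: `exponent_eq_zero_of_fst_ne` (a local embedding above `p` not at `v` is the conjugate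
  embedding, of exponent `qq w₀`), hence ★★ `avatarValueAt_eq_padicIntCast_zpow_of_type` —
  for `ε` of type `(pp, 0)`: `ε̂(σ) = (e_p(κ_v σ))^{pp w₀}` on `Gal(K̄/K(𝔪))`; for the endpoint's
  `(fun _ ↦ −m, fun _ ↦ 0)`: `ε̂(σ) = (e_p(κ_v σ))^{−m}` — the integrand of `∫ ε̂ dμ` on each cell of
  `Gal(K̄/K(𝔪))` IS the character of `EllipticUnitsLocal.integral_character_pow_succ_ellipticUnitsLocal`.

## References

* [deShalit1987] E. de Shalit, *Iwasawa theory of elliptic curves with complex multiplication* (1987),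
  II.4.13 (p. 69), II.4.14 (36)–(38) (p. 71–73).
* [SerreAbelianLadic1968] J.-P. Serre, *Abelian ℓ-adic representations and elliptic curves* (1968),
  Ch. II §2.7, Ch. III §1.1.
-/

noncomputable section

namespace Summit.BirchSwinnertonDyer.BirchSwinnertonDyer.Theorems.PrintCf2.AvatarOnRay

open scoped NumberField Topology nonZeroDivisors
open NumberField IsDedekindDomain IsDedekindDomain.HeightOneSpectrum Field
open Literature.NumberTheory.EllipticCurves Literature.NumberTheory.GaloisRepresentations
open Literature.NumberTheory.NumberFields

set_option linter.dupNamespace false -- D-0017: single-problem summit, `…BirchSwinnertonDyer.BirchSwinnertonDyer…` repeats a namespace by design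
set_option autoImplicit false

variable {p : ℕ} [hp : Fact p.Prime] {K : Type} [Field K] [NumberField K]

/-! ### §1. Exponent zero away from `v`: `Λ` sees only the `v`-component, and the identity is exact -/

section Exact

variable {v : HeightOneSpectrum (𝓞 K)}

/-- **`Λ(y) = 1` when `y_v = 1` and every local embedding above `p` away from `v` has exponent zero.**
[cite: SerreAbelianLadic1968, Ch. II §2.7] -/
theorem coe_algPart_eq_one_of_exponent_eq_zero (ι : PadicAlgCl p ≃+* ℂ) (pp qq : InfinitePlace K → ℤ)
    (hexp : ∀ f : PadicEmbedding.PlaceEmb K p, (f.1.1 : HeightOneSpectrum (𝓞 K)) ≠ v →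
      f.exponent ι pp qq = 0)
    {y : ideleGroup K} (hy : (y : AdeleRing (𝓞 K) K).2 v = 1) :
    (PadicEmbedding.algPart ι pp qq y : PadicAlgCl p) = 1 := by
  classical
  rw [PadicEmbedding.algPart_apply, Units.coe_prod]
  refine Finset.prod_eq_one fun f _ => ?_
  rw [Units.val_zpow_eq_zpow_val, PadicEmbedding.PlaceEmb.coe_eval]
  by_cases h : (f.1.1 : HeightOneSpectrum (𝓞 K)) = v
  · have hy' : (y : AdeleRing (𝓞 K) K).2 f.1.1 = 1 := by rw [h]; exact hy
    rw [hy', map_one, one_zpow]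
  · rw [hexp f h, neg_zero, zpow_zero]

variable [IsTotallyComplex K] {φ : HeckeCharacter K} {pp qq : InfinitePlace K → ℤ}
  {T : Finset (HeightOneSpectrum (𝓞 K))} {c : HeightOneSpectrum (𝓞 K) → ℕ} {𝔪 : Ideal (𝓞 K)}

/-- ★ **THE AVATAR ON THE RAY SUBGROUP IS EXACTLY THE ALGEBRAIC CHARACTER OF `κ_v`** when the exponents
away from `v` vanish. `K` totally complex, `φ` of infinity type `(pp, qq)` with module of definition
`(T, c) ≤ 𝔪`, `r` ANY `p`-adic avatar of `φ`, `v ∤ 𝔪`, `w_𝔪 = 1`, and every local embedding `(w, ẽ)`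
above `p` with `w ≠ v` of exponent `0` in `(pp, qq)`. Then for every `σ ∈ Gal(K̄/K(𝔪))`

  `avatarValueAt r σ = Λ(⟨κσ⟩_v)⁻¹`  (no depth hypothesis, no error term).

From `avatarValueAt_eq_of_mem_ker_rayClassField` (`φ̂(σ) = (ι⁻¹(φ⟨κσ⟩_v)·Λ(e))⁻¹`, `φ⟨κσ⟩_v = 1`):
`Λ(e) = Λ(⟨κσ⟩_v)·Λ(y)`, `y = ⟨κσ⟩_v⁻¹ e` has `y_v = 1`, and `Λ(y) = 1` by
`coe_algPart_eq_one_of_exponent_eq_zero`. [cite: deShalit1987, II.4.14 (36)–(38) (p. 71–73), II.4.13 (p. 69)]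
[cite: SerreAbelianLadic1968, Ch. II §2.7] -/
theorem avatarValueAt_eq_algPart_inv_localUnits (ι : PadicAlgCl p ≃+* ℂ)
    (hinf : φ.HasInfinityType pp qq) (hmod : φ.IsModulus T c)
    {r : FramedGaloisRep K (PadicAlgCl p) 1} (hav : IsPAdicAvatarOf ι φ r)
    (hle : ∀ w ∈ T, (c w : ℤ) ≤ FractionalIdeal.count K w (𝔪 : FractionalIdeal (𝓞 K)⁰ K))
    (h𝔪 : 𝔪 ≠ ⊥) (hv : ¬ 𝔪 ≤ v.asIdeal) (hw : ∀ u : (𝓞 K)ˣ, (u : 𝓞 K) - 1 ∈ 𝔪 → u = 1)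
    (hexp : ∀ f : PadicEmbedding.PlaceEmb K p, (f.1.1 : HeightOneSpectrum (𝓞 K)) ≠ v →
      f.exponent ι pp qq = 0)
    (σ : ↥(absRestrictNormalHom (rayClassField K 𝔪)).ker) :
    avatarValueAt r σ =
      ((((PadicEmbedding.algPart ι pp qq (localUnits v
          (Units.map ((v.adicCompletionIntegers K).subtype : _ →* _)
            (rayAdicCharacter h𝔪 hv hw σ))))⁻¹ : (PadicAlgCl p)ˣ) : PadicAlgCl p) : ℂ_[p]) := by
  classical
  obtain ⟨x, hx, -, -, hcomp, hval⟩ :=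
    avatarValueAt_eq_of_mem_ker_rayClassField h𝔪 hv hw hinf ι hav hmod (fun w hw' _ => hle w hw') σ
  set κu : (v.adicCompletionIntegers K)ˣ := rayAdicCharacter h𝔪 hv hw σ with hκu
  set cc : ideleGroup K := localUnits v (Units.map ((v.adicCompletionIntegers K).subtype : _ →* _) κu)
    with hcc
  -- `φ(⟨κσ⟩_v) = 1`
  have hφ1 : φ cc = 1 := HeckeCharacter.eq_one_of_mem_rayUnitIdeles hmod hle
    (localUnits_integer_mem_rayUnitIdeles h𝔪 hv κu) (infPart_localUnits v _)
  rw [hval, hφ1, Units.val_one, map_one, one_mul]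
  -- `y = cc⁻¹ x` has `y_v = 1`
  have hunit : ∀ w, Valued.v ((x : AdeleRing (𝓞 K) K).2 w) = 1 := valued_snd_eq_one_of_mem_rayUnitIdeles hx
  have hxv : (x : AdeleRing (𝓞 K) K).2 v = ((κu : v.adicCompletionIntegers K) : v.adicCompletion K) :=
    hcomp v hv
  have hyv : ((cc⁻¹ * x : ideleGroup K) : AdeleRing (𝓞 K) K).2 v = 1 := by
    have h0 : (x : AdeleRing (𝓞 K) K).2 v ≠ 0 := fun h' => by
      have h1 := hunit v; rw [h', map_zero] at h1; exact zero_ne_one h1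
    rw [ideleGroup_val_snd_mul, ideleGroup_val_inv_snd, hcc, localUnits_integer_snd_self, hxv,
      inv_mul_cancel₀ (hxv ▸ h0)]
  have hΛx : PadicEmbedding.algPart ι pp qq x =
      PadicEmbedding.algPart ι pp qq cc * PadicEmbedding.algPart ι pp qq (cc⁻¹ * x) := by
    rw [← map_mul, mul_inv_cancel_left]
  have hΛy : PadicEmbedding.algPart ι pp qq (cc⁻¹ * x) = 1 :=
    Units.ext (by rw [coe_algPart_eq_one_of_exponent_eq_zero ι pp qq hexp hyv, Units.val_one])
  rw [hΛx, hΛy, mul_one, Units.val_inv_eq_inv_val]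

end Exact

/-! ### §2. Degree one: `ε̂(σ) = padicIntCast ℂ_[p] (e_p (κσ)) ^ (pp w₀)` exactly -/

section DegreeOne

variable [IsTotallyComplex K] {ε : HeckeCharacter K} {pp qq : InfinitePlace K → ℤ}
  {T : Finset (HeightOneSpectrum (𝓞 K))} {em : HeightOneSpectrum (𝓞 K) → ℕ} {𝔪 : Ideal (𝓞 K)}
  {v : HeightOneSpectrum (𝓞 K)} [v.asIdeal.LiesOver (ratPlace p).asIdeal]

/-- ★★ **The exact identity at a split place of degree one, in the lane's currency.** `K` totally complex,
`ε` of infinity type `(pp, qq)` with module of definition `(T, e) ≤ 𝔪`, `e` any avatar, `v` of degree one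
over `p`, `v ∤ 𝔪`, `w_𝔪 = 1`, `v` THE place of `ι⁻¹ ∘ σ_{w₀}`, and every local embedding above `p` away
from `v` of exponent `0`. Then for every `σ ∈ Gal(K̄/K(𝔪))`, with `κ = rayAdicCharacter h𝔪 hv hw`,
`e_p = padicIntEquivOfDegreeOne`:

  `ε̂(σ) = padicIntCast ℂ_[p] (e_p (κσ)) ^ (pp w₀)`.

[cite: deShalit1987, II.4.14 (36)–(38) (p. 71–73), II.4.13 (p. 69)] [cite: SerreAbelianLadic1968, Ch. III §1.1] -/
theorem avatarValueAt_eq_padicIntCast_zpow (ι : PadicAlgCl p ≃+* ℂ)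
    (hinf : ε.HasInfinityType pp qq) (hmod : ε.IsModulus T em)
    {e : FramedGaloisRep K (PadicAlgCl p) 1} (hav : IsPAdicAvatarOf ι ε e)
    (hle : ∀ w ∈ T, (em w : ℤ) ≤ FractionalIdeal.count K w (𝔪 : FractionalIdeal (𝓞 K)⁰ K))
    (h𝔪 : 𝔪 ≠ ⊥) (hv : ¬ 𝔪 ≤ v.asIdeal) (hw : ∀ u : (𝓞 K)ˣ, (u : 𝓞 K) - 1 ∈ 𝔪 → u = 1)
    (he : v.asIdeal.ramificationIdx (𝓞 ℚ) = 1) (hf : v.asIdeal.inertiaDeg (𝓞 ℚ) = 1)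
    (hvp : ((p : ℕ) : 𝓞 K) ∈ v.asIdeal) {w₀ : InfinitePlace K}
    (hιv : ∀ d : 𝓞 K, d ∈ v.asIdeal ↔ ‖ι.symm (w₀.embedding (d : K))‖ < 1)
    (hexp : ∀ f : PadicEmbedding.PlaceEmb K p, (f.1.1 : HeightOneSpectrum (𝓞 K)) ≠ v →
      f.exponent ι pp qq = 0)
    {σ : absoluteGaloisGroup K} (hσ : σ ∈ (absRestrictNormalHom (rayClassField K 𝔪)).ker) :
    avatarValueAt e σ =
      padicIntCast ℂ_[p] (padicIntEquivOfDegreeOne K p v he hf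
        (rayAdicCharacter h𝔪 hv hw ⟨σ, hσ⟩ : v.adicCompletionIntegers K)) ^ (pp w₀) := by
  have h := avatarValueAt_eq_algPart_inv_localUnits ι hinf hmod hav hle h𝔪 hv hw hexp ⟨σ, hσ⟩
  rw [coe_algPart_inv_localUnits_of_degree_one ι pp qq he hf hvp, embExponent_eq_of_place ι pp qq he hf _ hιv,
    embExponent_embedding] at h
  rw [padicIntCast_padicComplex_eq_coe, PadicComplex.coe_eq, h, PadicComplex.coe_eq, map_zpow₀]

end DegreeOne

/-! ### §3. The exponent hypothesis for a field with ONE infinite place and `qq w₀ = 0` -/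

section OnePlace

variable {v : HeightOneSpectrum (𝓞 K)}

/-- **A local embedding above `p` NOT at `v` is the CONJUGATE embedding**, when `v` is the place of
`ι⁻¹ ∘ σ_{w₀}` and `w₀` is the only infinite place (`K` imaginary quadratic): its complex shadow
`ι ∘ ẽ ∘ ι_w` is not `σ_{w₀}` (whose `p`-adic place is `v`), hence has exponent `qq w₀` in `(pp, qq)`.
[cite: SerreAbelianLadic1968, Ch. II §2.7, §3.1] -/
theorem exponent_eq_of_fst_ne [IsTotallyComplex K] (ι : PadicAlgCl p ≃+* ℂ) (pp qq : InfinitePlace K → ℤ)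
    {w₀ : InfinitePlace K} (hw₀ : ∀ w : InfinitePlace K, w = w₀)
    (hιv : ∀ d : 𝓞 K, d ∈ v.asIdeal ↔ ‖ι.symm (w₀.embedding (d : K))‖ < 1)
    (f : PadicEmbedding.PlaceEmb K p) (hf : (f.1.1 : HeightOneSpectrum (𝓞 K)) ≠ v) :
    f.exponent ι pp qq = qq w₀ := by
  have hmk : InfinitePlace.mk ((ι : PadicAlgCl p →+* ℂ).comp f.toEmbedding) = w₀ := hw₀ _
  have hnr : ¬ ComplexEmbedding.IsReal ((ι : PadicAlgCl p →+* ℂ).comp f.toEmbedding) := fun h =>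
    (InfinitePlace.not_isReal_iff_isComplex.mpr (IsTotallyComplex.isComplex _)) ⟨_, h, rfl⟩
  -- `ι ∘ ẽ ∘ ι_w ≠ σ_{w₀}`: otherwise the place of `ẽ ∘ ι_w = ι⁻¹ ∘ σ_{w₀}` would be `v`
  have hne : (ι : PadicAlgCl p →+* ℂ).comp f.toEmbedding ≠
      (InfinitePlace.mk ((ι : PadicAlgCl p →+* ℂ).comp f.toEmbedding)).embedding := by
    rw [hmk]
    intro h
    apply hf
    have hτ : ∀ x : K, f.toEmbedding x = ι.symm (w₀.embedding x) := fun x => by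
      have hx := RingHom.congr_fun h x
      simp only [RingHom.coe_comp, Function.comp_apply, RingHom.coe_coe] at hx
      rw [← hx, RingEquiv.symm_apply_apply]
    have hplace : PadicEmbedding.place f.toEmbedding = v :=
      place_eq_of_forall_mem_iff fun d => by rw [hτ]; exact hιv d
    exact (PadicEmbedding.place_comp_algebraMap f.2.1 f.2.2).symm.trans hplace
  unfold PadicEmbedding.PlaceEmb.exponent HeckeCharacter.embExponent
  rw [if_neg hnr, if_neg hne, hmk]

/-- The exponent hypothesis of §1–§2 for `qq w₀ = 0`. [cite: SerreAbelianLadic1968, Ch. II §2.7] -/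
theorem exponent_eq_zero_of_fst_ne [IsTotallyComplex K] (ι : PadicAlgCl p ≃+* ℂ) (pp qq : InfinitePlace K → ℤ)
    {w₀ : InfinitePlace K} (hw₀ : ∀ w : InfinitePlace K, w = w₀) (hqq : qq w₀ = 0)
    (hιv : ∀ d : 𝓞 K, d ∈ v.asIdeal ↔ ‖ι.symm (w₀.embedding (d : K))‖ < 1)
    (f : PadicEmbedding.PlaceEmb K p) (hf : (f.1.1 : HeightOneSpectrum (𝓞 K)) ≠ v) :
    f.exponent ι pp qq = 0 :=
  (exponent_eq_of_fst_ne ι pp qq hw₀ hιv f hf).trans hqq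

variable [IsTotallyComplex K] {ε : HeckeCharacter K} {pp qq : InfinitePlace K → ℤ}
  {T : Finset (HeightOneSpectrum (𝓞 K))} {em : HeightOneSpectrum (𝓞 K) → ℕ} {𝔪 : Ideal (𝓞 K)}
  [v.asIdeal.LiesOver (ratPlace p).asIdeal]

/-- ★★ **de Shalit II.4.14 at `j = 0`: on `Gal(K̄/K(𝔪))` the avatar of a character of type `(pp, qq)` with
`qq w₀ = 0` IS the monomial `(e_p(κ_v σ))^{pp w₀}`** — `K` with one infinite place `w₀` (imaginary
quadratic), `v` of degree one, THE place of `ι⁻¹ ∘ σ_{w₀}`, module of definition `≤ 𝔪`, `v ∤ 𝔪`, `w_𝔪 = 1`,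
ANY avatar `e`. For the R3 endpoint's type `(fun _ ↦ −m, fun _ ↦ 0)`: `ε̂(σ) = (e_p(κ_v σ))^{−m}` — the
integrand on each cell of `Gal(K̄/K(𝔪))` is EXACTLY the character of
`EllipticUnitsLocal.integral_character_pow_succ_ellipticUnitsLocal` (no `p^{−N}` error, no depth at `v̄`).
[cite: deShalit1987, II.4.14 (36)–(38) (p. 71–73), II.4.13 (p. 69)] -/
theorem avatarValueAt_eq_padicIntCast_zpow_of_type (ι : PadicAlgCl p ≃+* ℂ)
    (hinf : ε.HasInfinityType pp qq) (hmod : ε.IsModulus T em)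
    {e : FramedGaloisRep K (PadicAlgCl p) 1} (hav : IsPAdicAvatarOf ι ε e)
    (hle : ∀ w ∈ T, (em w : ℤ) ≤ FractionalIdeal.count K w (𝔪 : FractionalIdeal (𝓞 K)⁰ K))
    (h𝔪 : 𝔪 ≠ ⊥) (hv : ¬ 𝔪 ≤ v.asIdeal) (hw : ∀ u : (𝓞 K)ˣ, (u : 𝓞 K) - 1 ∈ 𝔪 → u = 1)
    (he : v.asIdeal.ramificationIdx (𝓞 ℚ) = 1) (hf : v.asIdeal.inertiaDeg (𝓞 ℚ) = 1)
    (hvp : ((p : ℕ) : 𝓞 K) ∈ v.asIdeal) {w₀ : InfinitePlace K} (hw₀ : ∀ w : InfinitePlace K, w = w₀)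
    (hqq : qq w₀ = 0) (hιv : ∀ d : 𝓞 K, d ∈ v.asIdeal ↔ ‖ι.symm (w₀.embedding (d : K))‖ < 1)
    {σ : absoluteGaloisGroup K} (hσ : σ ∈ (absRestrictNormalHom (rayClassField K 𝔪)).ker) :
    avatarValueAt e σ =
      padicIntCast ℂ_[p] (padicIntEquivOfDegreeOne K p v he hf
        (rayAdicCharacter h𝔪 hv hw ⟨σ, hσ⟩ : v.adicCompletionIntegers K)) ^ (pp w₀) :=
  avatarValueAt_eq_padicIntCast_zpow ι hinf hmod hav hle h𝔪 hv hw he hf hvp hιv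
    (exponent_eq_zero_of_fst_ne ι pp qq hw₀ hqq hιv) hσ

end OnePlace

end Summit.BirchSwinnertonDyer.BirchSwinnertonDyer.Theorems.PrintCf2.AvatarOnRay
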